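import Summits.QuantumFields.BalabanUV.Beta.FP.NearRegionCrossBubble
import Summits.QuantumFields.BalabanUV.Beta.FP.GhostLoopCountingWindow
import Summits.QuantumFields.BalabanUV.Beta.FP.BlockAveragedKernel

/-!
# `BalabanUV.Beta.FP.SliceLoopWindowLetters` — road «FP» (binder row D1), organisation γ, row **GAMMA-6 (W) «WINDOW LETTERS»** (owner ruling R-FP-28 (c),
# journal l.25755), PART 1 (generic): THE EXPONENTIALLY WEIGHTED WINDOW ROW MASSES OF ONE LEIBNIZ-PLACED TERM — window sums on `ℤ⁴`, the passage from a
# POINTWISE windowed decay letter to the row-mass letter (K) of `FP/CoarseContractionProfile`, the decay-transfer under a bounded shift, the column's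
# GENERAL-SHIFT unit-difference letter, and the window's jump bookkeeping — the inputs of PART 2 `FP/SliceLoopWindowTerms` (the three letters
# (K̃) ∕ (K₀-interior) ∕ (K₀-shell) of ONE Leibniz-placed term of `FP/SliceLoopPairing.kernel_leibniz`)
# ([folklore] lattice bookkeeping; no road object is typed or touched)

HONEST DEPENDENCY (page 1, mandatory): continuum YM on T⁴ ⇐ BetaPertH ∧ nine spine estimates (0/9 proved); BetaPertH ⇐ (D1) ∧ (D4) ∧
CAP+tail; G-an2-4 gates asym, D1 and NE2/3/4.  HONEST FRAMING (cell contract, verbatim): «discharging `BetaPertH` makes Bałaban's UV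
stability UNCONDITIONAL — a real constructive-QFT result; it is NOT the continuum limit and NOT the Clay problem.»  THIS MODULE is elementary [folklore]
real analysis on `ℤ⁴ = DyadicShell.Pt` over the tree's shell engine (`TransferUV.card_annulus_succ_four_le`, `DyadicShell.sum_Ico_shellSum`,
`FP/NearRegionCrossBubble.sum_annulus_le_of_shell_bound` ∕ `sum_range_succ_pow_le`, `FP/GhostLoopCountingWindow.sum_box_inv_cube_le`, `FP/BlockAveragedKernel.sum_box_eq_add_sum_annulus`), the lattice path bound `FP/LatticeTaylorPath.abs_taylor0D_le` and the box
letter `FP/HorizontalBookkeepingTail.supNorm_le_add_of_box` BY NAME; every analytic input (the legs' letters, the column's unit-difference profile) is a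
HYPOTHESIS displayed in the signatures.  It cites nothing, defines nothing, mints no `Prop` fact, 0 sorry.  It is NOT the smeared cross kernel's assembled (pp)
(PART 2 `FP/SliceLoopWindowCross`), NOT (pp)∕(rem) for any road piece (the road's `F := P^{BF}`∕`Γ`, `R := R_n`, `c := Ḣ` are RHOA-8 ∕ GAMMA-8's instances),
NOT hbook, NOT D1, NOT BetaPertH, NOT continuum, NOT Clay.

ABSOLUTE RULE (cell charter, verbatim): «No internally-minted statement may enter as a cited fact. Every hypothesis is either kernel-proved in this
package or a verbatim quotation of a PUBLISHED theorem with page reference. The manuscript(s) under audit are NOT citable for their own disputed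
steps — they are the thing under adjudication; programme-internal (2001/route/tribunal) claims are never citable.»

WHY (R-FP-28 (b)(c); `CoarseContractionProfile` ∕ `SliceLoopPairing` headers).  `SliceLoopPairing.pp_of_pairs` ∕ `pp_of_leibniz` turn the exponentially weighted
ROW-MASS letters (K₀) `Σ_{b′} e^{(γ∕(2n))‖b′−b‖∞}|k₀ b b′| ≤ M₀` and (K̃) `… |k̃ b b′| ≤ M̃` into the (pp) letter; THIS FILE produces `M₀`, `M̃` for ONE Leibniz-placed
windowed term from the legs' letters, with every constant crude-explicit:
* the long leg `G b b′` carrying its ONE difference: `|G b b′| ≤ A∕(‖b′−b‖∞+1)³` (on the road `A ≍ A₁·|y|`, degree `−3`);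
* the smooth leg: `|ρ b b′| ≤ Bρ₀`, `|ρ b (b′+w) − ρ b b′| ≤ Bρ₁` (on the road `Bρ_j = B·n^{−2−j}`);
* the window `χ b b′ = 𝟙[‖b′−b‖∞ ≤ N]`, `1 ≤ N` (on the road `N = R₀·n`), a UNIT shift `‖w‖∞ ≤ 1`;
⟹ (PART 2) (K̃) `M̃ = e^{(γ∕(2n))N}·Bρ₀·A·W_m(N)` with the window sums of THIS file `W₃(N) = 1 + 80N`, `W₂(N) = 1 + 80N²` (≍ `A·B·R₀·n⁻¹` in both
channels of the placement table), (K₀-interior) `e^{(γ∕(2n))(N+1)}·Bρ₁·2ᵐA·W_m(N+1)` (≍ `A·B·R₀·n⁻²`), (K₀-shell) `e^{(γ∕(2n))(N+1)}·Bρ₀·A·160·4ᵐ(N+1)^{3−m}`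
(≍ `A·B·n⁻²`) — LINEAR in `N` at worst, NO logarithm: the placement rule of (L) is what makes a degree `−3` leg meet `Σ_{‖z‖≤N}(‖z‖+1)⁻³ ≤ 1 + 80N` instead of
the R-γ-15 logarithm.

CONTENT.
* §1 window sums on `ℤ⁴` (the cubic one `Σ_{‖z‖∞≤N}(‖z‖∞+1)⁻³ ≤ 1 + 80N` IS `FP/GhostLoopCountingWindow.sum_box_inv_cube_le` ✓ (beta-d1-formalise-leaf-05, (g1)) and the
  punctured-box split IS `FP/BlockAveragedKernel.sum_box_eq_add_sum_annulus` ✓ — both imported BY NAME, not restated): `sum_box_inv_sq_le` (`≤ 1 + 80N²`),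
  `card_annulus_le` (`#{a < ‖z‖∞ ≤ N} ≤ 80·(N−a)·N³`).
* §2 `sum_le_sum_box_of_support`, **`rowMass_le_of_window`** (pointwise windowed majorant ⟹ the exp-weighted row mass, weight cost `e^{(γ∕(2n))N}`).
* §3 `succ_le_mul_succ_of_shift` (`‖z‖+1 ≤ (‖p‖+1)(‖z+p‖+1)`), **`inv_pow_shift_le`** (`(‖z+p‖∞+1)⁻ᵐ ≤ (‖p‖∞+1)ᵐ·(‖z‖∞+1)⁻ᵐ`), `inv_pow_unit_shift_le`;
  the window's bookkeeping `abs_window_le_one`, `window_jump_support` (the jump of `𝟙[‖·‖∞ ≤ N]` under a unit shift lives on `N−1 < ‖z‖∞ ≤ N+1`),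
  `abs_window_jump_le_one`, `window_shift_support`, `sum_box_indicator_shell_le` (`≤ 160(N+1)³·c`).
* §4 **`abs_shift_sub_le_of_unit`** — the column's GENERAL-SHIFT letter from its UNIT-difference profile: `|J(p+x) − J p| ≤ 4‖x‖∞·C_Δ·e^{(γ∕n)‖x‖∞}·e^{−(γ∕n)‖p−c‖∞}`
  (`abs_taylor0D_le` + recentring); for the vertex offsets `‖x‖∞ < n` of a window piece the recentring costs the constant `e^{γ}`.
PART 2 `FP/SliceLoopWindowTerms` turns these into the three letters (K̃) ∕ (K₀-interior) ∕ (K₀-shell) of ONE Leibniz-placed term.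
Unit `b2b-balaban-gan24-formalise-leaf-05` (gen 37; G-an2-4 swarm leaf seat, cross-lane on road FP; first refusal R-FP-28 (c)), 2026-08-21; `LEAVES-FP.md` row GAMMA-6;
journal MINE l.26308.  «not in print; our bookkeeping».
-/

noncomputable section

namespace Summit.QuantumFields.BalabanUV.Beta.FP.SliceLoopWindowLetters

open Finset Real fwdDiff
open scoped BigOperators
open Literature.Probability.LatticeModels (box annulus zero_mem_box)
open Literature.MathematicalPhysics.QuantumFieldTheory.Balaban1983to89.Beta
open Literature.MathematicalPhysics.QuantumFieldTheory.Balaban1983to89.Beta.TransferUV (card_annulus_succ_four_le)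
open Literature.MathematicalPhysics.QuantumFieldTheory.Balaban1983to89.Beta.WindowLog (shellSum)
open DyadicShell (Pt supNorm mem_box_iff mem_annulus_iff natAbs_le_supNorm supNorm_le_iff supNorm_eq_of_mem_sphere sum_Ico_shellSum
  supNorm_eq_zero_iff)
open Summit.QuantumFields.BalabanUV.Beta.FP.NearRegionCrossBubble (sum_annulus_le_of_shell_bound sum_range_succ_pow_le)
open Summit.QuantumFields.BalabanUV.Beta.FP.GhostLoopCountingWindow (sum_box_inv_cube_le)
open Summit.QuantumFields.BalabanUV.Beta.FP.BlockAveragedKernel (sum_box_eq_add_sum_annulus)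
open Summit.QuantumFields.BalabanUV.Beta.FP.LatticeTaylorPath (abs_taylor0D_le)
open Summit.QuantumFields.BalabanUV.Beta.FP.HorizontalBookkeepingTail (supNorm_le_add_of_box)

/-! ## §1 Window sums on `ℤ⁴` -/

/-- [folklore] THE QUADRATIC WINDOW SUM: `Σ_{‖z‖∞ ≤ N} (‖z‖∞+1)⁻² ≤ 1 + 80·N²` (shells against `(r+2)⁻²`, then `Σ_{r<N}(r+1) ≤ N²`). -/
theorem sum_box_inv_sq_le (N : ℕ) :
    ∑ z ∈ box 4 N, (((supNorm z : ℝ) + 1) ^ 2)⁻¹ ≤ 1 + 80 * (N : ℝ) ^ 2 := by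
  rw [sum_box_eq_add_sum_annulus]
  have h0 : (((supNorm (0 : Pt) : ℝ) + 1) ^ 2)⁻¹ = 1 := by
    rw [supNorm_eq_zero_iff.mpr rfl]; norm_num
  rw [h0]
  refine add_le_add le_rfl ?_
  have h := sum_annulus_le_of_shell_bound (g := fun z : Pt => (((supNorm z : ℝ) + 1) ^ 2)⁻¹) (φ := fun r => (((r : ℝ) + 1 + 1) ^ 2)⁻¹)
    (fun r => by positivity) (fun r w hw => by
      have e := supNorm_eq_of_mem_sphere hw
      simp only [e, Nat.cast_add, Nat.cast_one]; exact le_rfl) N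
  refine h.trans ?_
  calc ∑ r ∈ Finset.range N, 80 * ((r : ℝ) + 1) ^ 3 * (((r : ℝ) + 1 + 1) ^ 2)⁻¹
      ≤ ∑ r ∈ Finset.range N, 80 * ((r : ℝ) + 1) ^ 1 := Finset.sum_le_sum fun r _ => by
        rw [mul_assoc, ← div_eq_mul_inv, pow_one]
        have hr : (0 : ℝ) ≤ r := Nat.cast_nonneg r
        have h1 : ((r : ℝ) + 1) ^ 3 / ((r : ℝ) + 1 + 1) ^ 2 ≤ (r : ℝ) + 1 := by
          rw [div_le_iff₀ (by positivity)]
          nlinarith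
        linarith
    _ = 80 * ∑ r ∈ Finset.range N, ((r : ℝ) + 1) ^ 1 := by rw [Finset.mul_sum]
    _ ≤ 80 * (N : ℝ) ^ 2 := mul_le_mul_of_nonneg_left (sum_range_succ_pow_le N 1) (by norm_num)

/-- [folklore] **THE THICK SHELL**: `#{a < ‖z‖∞ ≤ N} ≤ 80·(N − a)·N³` for `a ≤ N` (each of the `N − a` shells has at most `80·N³` points). -/
theorem card_annulus_le {a N : ℕ} (haN : a ≤ N) : ((annulus 4 a N).card : ℝ) ≤ 80 * ((N : ℝ) - a) * (N : ℝ) ^ 3 := by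
  have e : ((annulus 4 a N).card : ℝ) = ∑ w ∈ annulus 4 a N, (1 : ℝ) := by simp
  rw [e, ← sum_Ico_shellSum (fun _ => (1 : ℝ)) haN]
  have hs : ∀ r ∈ Finset.Ico a N, shellSum (fun _ => (1 : ℝ)) r ≤ 80 * (N : ℝ) ^ 3 := by
    intro r hr
    have hrN : (r : ℝ) + 1 ≤ N := by exact_mod_cast (Finset.mem_Ico.mp hr).2
    rw [shellSum]
    calc ∑ _w ∈ annulus 4 r (r + 1), (1 : ℝ) = ((annulus 4 r (r + 1)).card : ℝ) := by simp
      _ ≤ 80 * ((r : ℝ) + 1) ^ 3 := card_annulus_succ_four_le r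
      _ ≤ 80 * (N : ℝ) ^ 3 := by gcongr
  calc ∑ r ∈ Finset.Ico a N, shellSum (fun _ => (1 : ℝ)) r ≤ ∑ _r ∈ Finset.Ico a N, 80 * (N : ℝ) ^ 3 := Finset.sum_le_sum hs
    _ = 80 * ((N : ℝ) - a) * (N : ℝ) ^ 3 := by
        rw [Finset.sum_const, Nat.card_Ico, nsmul_eq_mul, Nat.cast_sub haN]; ring

/-! ## §2 From a pointwise windowed majorant to the exponentially weighted row mass -/

/-- [folklore] A non-negative function supported in the box `‖z‖∞ ≤ N` has every finite sum bounded by its box sum. -/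
theorem sum_le_sum_box_of_support {h : Pt → ℝ} {N : ℕ} (hh : ∀ z, 0 ≤ h z) (hsupp : ∀ z, h z ≠ 0 → supNorm z ≤ N) (A : Finset Pt) :
    ∑ z ∈ A, h z ≤ ∑ z ∈ box 4 N, h z := by
  classical
  rw [← Finset.sum_filter_ne_zero A]
  refine Finset.sum_le_sum_of_subset_of_nonneg (fun z hz => ?_) (fun z _ _ => hh z)
  rw [Finset.mem_filter] at hz
  exact mem_box_iff.mpr (hsupp z hz.2)

/-- [folklore] **THE ROW-MASS LETTER FROM A POINTWISE WINDOWED MAJORANT**: if `|g b′| ≤ φ(b′ − b)` and `g b′ = 0` unless `‖b′ − b‖∞ ≤ N`, then for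
every finite `S′` and `γ ≥ 0`, `n ≥ 1`: `Σ_{b′∈S′} e^{(γ∕(2n))‖b′−b‖∞}·|g b′| ≤ e^{(γ∕(2n))·N}·Σ_{‖z‖∞ ≤ N} φ z` — the exponential weight of the (K)-letters of
`CoarseContractionProfile` costs a constant on a window. -/
theorem rowMass_le_of_window {γ : ℝ} {n N : ℕ} (hγ : 0 ≤ γ) {g : Pt → ℝ} (b : Pt) {φ : Pt → ℝ}
    (hg : ∀ b', |g b'| ≤ φ (b' - b)) (hsupp : ∀ b', g b' ≠ 0 → supNorm (b' - b) ≤ N) (S' : Finset Pt) :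
    ∑ b' ∈ S', Real.exp ((γ / (2 * n)) * (supNorm (b' - b) : ℝ)) * |g b'|
      ≤ Real.exp ((γ / (2 * n)) * N) * ∑ z ∈ box 4 N, φ z := by
  classical
  have ht : 0 ≤ γ / (2 * n) := by positivity
  -- reindex by `z = b′ − b`
  set h : Pt → ℝ := fun z => Real.exp ((γ / (2 * n)) * (supNorm z : ℝ)) * |g (z + b)| with hh
  have e1 : ∑ b' ∈ S', Real.exp ((γ / (2 * n)) * (supNorm (b' - b) : ℝ)) * |g b'| = ∑ z ∈ S'.image (fun b' => b' - b), h z := by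
    rw [Finset.sum_image (fun x _ y _ hxy => sub_left_injective hxy)]
    refine Finset.sum_congr rfl fun b' _ => ?_
    simp [hh]
  have hsupp' : ∀ z, h z ≠ 0 → supNorm z ≤ N := by
    intro z hz
    have hg' : g (z + b) ≠ 0 := by
      intro h0; apply hz; simp [hh, h0]
    simpa using hsupp (z + b) hg'
  have e2 := sum_le_sum_box_of_support (fun z => by positivity) hsupp' (S'.image (fun b' => b' - b))
  rw [e1]
  refine e2.trans ?_
  rw [Finset.mul_sum]
  refine Finset.sum_le_sum fun z hz => ?_
  have hzN : (supNorm z : ℝ) ≤ N := by exact_mod_cast mem_box_iff.mp hz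
  have hgz : |g (z + b)| ≤ φ z := by simpa using hg (z + b)
  calc h z = Real.exp ((γ / (2 * n)) * (supNorm z : ℝ)) * |g (z + b)| := rfl
    _ ≤ Real.exp ((γ / (2 * n)) * N) * φ z :=
        mul_le_mul (Real.exp_le_exp.mpr (mul_le_mul_of_nonneg_left hzN ht)) hgz (abs_nonneg _) (Real.exp_pos _).le

/-! ## §3 Decay transfer under a bounded shift -/

/-- [folklore] `‖z‖∞ + 1 ≤ (‖p‖∞ + 1)·(‖z + p‖∞ + 1)` (real form; from `‖z‖∞ ≤ ‖z+p‖∞ + ‖p‖∞`). -/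
theorem succ_le_mul_succ_of_shift (z p : Pt) :
    (supNorm z : ℝ) + 1 ≤ ((supNorm p : ℝ) + 1) * ((supNorm (z + p) : ℝ) + 1) := by
  have h1 : (supNorm z : ℝ) ≤ supNorm (z + p) + supNorm p := by
    have h := BlockLegs.supNorm_sub_le_real (z + p) p
    simpa using h
  have hp : (0 : ℝ) ≤ supNorm p := Nat.cast_nonneg _
  have hz : (0 : ℝ) ≤ supNorm (z + p) := Nat.cast_nonneg _
  nlinarith

/-- [folklore] **DECAY TRANSFER UNDER A BOUNDED SHIFT**: `(‖z+p‖∞+1)⁻ᵐ ≤ (‖p‖∞+1)ᵐ·(‖z‖∞+1)⁻ᵐ` — a leg read at a shifted point keeps its window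
decay at the price of a polynomial in the shift (absorbed by the vertex weights' path-length moments). -/
theorem inv_pow_shift_le (m : ℕ) (z p : Pt) :
    (((supNorm (z + p) : ℝ) + 1) ^ m)⁻¹ ≤ ((supNorm p : ℝ) + 1) ^ m * (((supNorm z : ℝ) + 1) ^ m)⁻¹ := by
  have h := succ_le_mul_succ_of_shift z p
  have hz : (0 : ℝ) < (supNorm z : ℝ) + 1 := by positivity
  have hzp : (0 : ℝ) < (supNorm (z + p) : ℝ) + 1 := by positivity
  rw [← div_eq_mul_inv, le_div_iff₀ (by positivity)]
  have h3 := pow_le_pow_left₀ hz.le h m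
  calc (((supNorm (z + p) : ℝ) + 1) ^ m)⁻¹ * ((supNorm z : ℝ) + 1) ^ m
      ≤ (((supNorm (z + p) : ℝ) + 1) ^ m)⁻¹ * (((supNorm p : ℝ) + 1) * ((supNorm (z + p) : ℝ) + 1)) ^ m :=
        mul_le_mul_of_nonneg_left h3 (by positivity)
    _ = ((supNorm p : ℝ) + 1) ^ m := by
        rw [mul_pow]; field_simp

/-- [folklore] UNIT SHIFT: `(‖z+w‖∞+1)⁻ᵐ ≤ 2ᵐ·(‖z‖∞+1)⁻ᵐ` for `‖w‖∞ ≤ 1`. -/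
theorem inv_pow_unit_shift_le (m : ℕ) (z : Pt) {w : Pt} (hw : supNorm w ≤ 1) :
    (((supNorm (z + w) : ℝ) + 1) ^ m)⁻¹ ≤ 2 ^ m * (((supNorm z : ℝ) + 1) ^ m)⁻¹ := by
  refine (inv_pow_shift_le m z w).trans (mul_le_mul_of_nonneg_right ?_ (by positivity))
  have : (supNorm w : ℝ) ≤ 1 := by exact_mod_cast hw
  exact pow_le_pow_left₀ (by positivity) (by linarith) m

/-- [folklore] THE WINDOW CUTOFF AS A REAL FUNCTION: `χ b b′ = 𝟙[‖b′−b‖∞ ≤ N]` takes values in `{0,1}`, so `|χ b b′| ≤ 1`. -/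
theorem abs_window_le_one {χ : Pt → Pt → ℝ} {N : ℕ} (hχ : ∀ b b', χ b b' = if supNorm (b' - b) ≤ N then 1 else 0) (b b' : Pt) :
    |χ b b'| ≤ 1 := by
  rw [hχ]; split_ifs <;> simp

/-- [folklore] THE JUMP OF THE WINDOW lives on the two shells `‖b′−b‖∞ ∈ {N, N+1}` for a unit shift `‖w‖∞ ≤ 1` (`1 ≤ N`):
`χ b (b′+w) ≠ χ b b′ ⟹ N − 1 < ‖b′−b‖∞ ≤ N + 1`, and `|χ b (b′+w) − χ b b′| ≤ 1`. -/
theorem window_jump_support {χ : Pt → Pt → ℝ} {N : ℕ} {w : Pt} (hχ : ∀ b b', χ b b' = if supNorm (b' - b) ≤ N then 1 else 0)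
    (hw : supNorm w ≤ 1) (hN : 1 ≤ N) (b b' : Pt) (hne : χ b (b' + w) - χ b b' ≠ 0) :
    N - 1 < supNorm (b' - b) ∧ supNorm (b' - b) ≤ N + 1 := by
  have h1 : (supNorm (b' - b) : ℝ) ≤ supNorm (b' + w - b) + supNorm w := by
    have h := BlockLegs.supNorm_sub_le_real (b' + w - b) w
    rwa [show b' + w - b - w = b' - b by abel] at h
  have h2 : (supNorm (b' + w - b) : ℝ) ≤ supNorm (b' - b) + supNorm w := by
    have h := BlockLegs.supNorm_add_le_real (b' - b) w
    rwa [show b' - b + w = b' + w - b by abel] at h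
  have hwr : (supNorm w : ℝ) ≤ 1 := by exact_mod_cast hw
  rw [hχ, hχ] at hne
  by_cases hA1 : supNorm (b' + w - b) ≤ N
  · by_cases hB1 : supNorm (b' - b) ≤ N
    · exact absurd (by rw [if_pos hA1, if_pos hB1]; ring) hne
    · refine ⟨by omega, ?_⟩
      have : (supNorm (b' + w - b) : ℝ) ≤ N := by exact_mod_cast hA1
      have : (supNorm (b' - b) : ℝ) ≤ N + 1 := by linarith
      exact_mod_cast this
  · by_cases hB1 : supNorm (b' - b) ≤ N
    · refine ⟨?_, by omega⟩
      have hA2 : (N : ℝ) < supNorm (b' + w - b) := by exact_mod_cast (not_le.mp hA1)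
      have : (N : ℝ) - 1 < supNorm (b' - b) := by linarith
      have : ((N - 1 : ℕ) : ℝ) < supNorm (b' - b) := by rw [Nat.cast_sub hN]; simpa using this
      exact_mod_cast this
    · exact absurd (by rw [if_neg hA1, if_neg hB1]; ring) hne

/-- [folklore] `|χ b (b′+w) − χ b b′| ≤ 1` for the `{0,1}`-valued window. -/
theorem abs_window_jump_le_one {χ : Pt → Pt → ℝ} {N : ℕ} (hχ : ∀ b b', χ b b' = if supNorm (b' - b) ≤ N then 1 else 0) (b b' w : Pt) :
    |χ b (b' + w) - χ b b'| ≤ 1 := by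
  rw [hχ, hχ]; split_ifs <;> norm_num

/-- [folklore] A SHIFTED WINDOW: `χ b (b′+w) ≠ 0 ⟹ ‖b′−b‖∞ ≤ N + 1` for `‖w‖∞ ≤ 1`. -/
theorem window_shift_support {χ : Pt → Pt → ℝ} {N : ℕ} {w : Pt} (hχ : ∀ b b', χ b b' = if supNorm (b' - b) ≤ N then 1 else 0)
    (hw : supNorm w ≤ 1) (b b' : Pt) (hne : χ b (b' + w) ≠ 0) : supNorm (b' - b) ≤ N + 1 := by
  have hle : supNorm (b' + w - b) ≤ N := by
    by_contra h; apply hne; rw [hχ, if_neg h]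
  have h1 : (supNorm (b' - b) : ℝ) ≤ supNorm (b' + w - b) + supNorm w := by
    have h := BlockLegs.supNorm_sub_le_real (b' + w - b) w
    rwa [show b' + w - b - w = b' - b by abel] at h
  have : (supNorm (b' + w - b) : ℝ) ≤ N := by exact_mod_cast hle
  have : (supNorm w : ℝ) ≤ 1 := by exact_mod_cast hw
  have : (supNorm (b' - b) : ℝ) ≤ N + 1 := by linarith
  exact_mod_cast this

/-- [folklore] THE THICK-SHELL SUM of a constant: `Σ_{z ∈ box (N+1)} 𝟙[N−1 < ‖z‖∞]·c = #annulus 4 (N−1) (N+1)·c ≤ 160·(N+1)³·c` (`1 ≤ N`, `0 ≤ c`). -/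
theorem sum_box_indicator_shell_le {N : ℕ} (hN : 1 ≤ N) {c : ℝ} (hc : 0 ≤ c) :
    ∑ z ∈ box 4 (N + 1), (if N - 1 < supNorm z then c else 0) ≤ 160 * ((N : ℝ) + 1) ^ 3 * c := by
  classical
  have hN' : (1 : ℝ) ≤ N := by exact_mod_cast hN
  have hfilt : (box 4 (N + 1)).filter (fun z => N - 1 < supNorm z) = annulus 4 (N - 1) (N + 1) := by
    ext z
    simp only [Finset.mem_filter, mem_box_iff, mem_annulus_iff]
    tauto
  rw [← Finset.sum_filter, hfilt, Finset.sum_const, nsmul_eq_mul]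
  have hcard := card_annulus_le (a := N - 1) (N := N + 1) (by omega)
  have hcard' : ((annulus 4 (N - 1) (N + 1)).card : ℝ) ≤ 160 * ((N : ℝ) + 1) ^ 3 := by
    refine hcard.trans ?_
    rw [Nat.cast_sub hN, Nat.cast_add, Nat.cast_one]
    ring_nf; nlinarith [hN']
  exact mul_le_mul_of_nonneg_right hcard' hc

/-! ## §4 The column's general-shift letter from its unit-difference profile -/

/-- [folklore] **GENERAL SHIFT FROM UNIT STEPS**: if a column `J` has the unit-difference profile `|J(p + e_i) − J p| ≤ C_Δ·e^{−(γ∕n)‖p − c‖∞}` for every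
`p` and coordinate `i` (`γ ≥ 0`, `n ≥ 1`), then for every shift `x`:
`|J(p + x) − J p| ≤ 4·‖x‖∞·C_Δ·e^{(γ∕n)‖x‖∞}·e^{−(γ∕n)‖p − c‖∞}` — the lattice path `FP/LatticeTaylorPath.abs_taylor0D_le` with the profile recentred on
the coordinate box of radius `‖x‖∞` (for window offsets `‖x‖∞ < n` the recentring is the constant `e^{γ}`). -/
theorem abs_shift_sub_le_of_unit {γ CΔ : ℝ} {n : ℕ} (hγ : 0 ≤ γ) (hn : 1 ≤ n) {J : Pt → ℝ} {c : Pt}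
    (hJ : ∀ (p : Pt) (i : Fin 4), |J (p + Pi.single i 1) - J p| ≤ CΔ * Real.exp (-(γ / n) * (supNorm (p - c) : ℝ))) (p x : Pt) :
    |J (p + x) - J p| ≤ 4 * (supNorm x : ℝ) * CΔ * Real.exp ((γ / n) * (supNorm x : ℝ)) * Real.exp (-(γ / n) * (supNorm (p - c) : ℝ)) := by
  have hCΔ : 0 ≤ CΔ := by
    have h := hJ c 0
    have e : Real.exp (-(γ / n) * (supNorm (c - c) : ℝ)) = 1 := by simp [supNorm_eq_zero_iff.mpr]
    rw [e, mul_one] at h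
    exact (abs_nonneg _).trans h
  have ht : 0 ≤ γ / n := by positivity
  set B : ℝ := CΔ * Real.exp ((γ / n) * (supNorm x : ℝ)) * Real.exp (-(γ / n) * (supNorm (p - c) : ℝ)) with hB
  have hB0 : 0 ≤ B := by positivity
  have hs : ∀ i, |x i| ≤ ((supNorm x : ℕ) : ℤ) := fun i => by
    have := natAbs_le_supNorm x i
    rw [← Int.natCast_natAbs]; exact_mod_cast this
  have h := abs_taylor0D_le (f := J) (p := p) (s := x) hs hB0 (fun t ht' i => ?_)
  · calc |J (p + x) - J p| ≤ (4 : ℕ) * ((supNorm x : ℕ) : ℝ) * B := by simpa using h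
      _ = 4 * (supNorm x : ℝ) * CΔ * Real.exp ((γ / n) * (supNorm x : ℝ)) * Real.exp (-(γ / n) * (supNorm (p - c) : ℝ)) := by
          simp only [hB, Nat.cast_ofNat]; ring
  · -- the profile on the box: `‖p − c‖ ≤ ‖t − c‖ + ‖x‖∞`
    have hbox : supNorm (p - c) ≤ supNorm (t - c) + supNorm x := by
      refine supNorm_le_add_of_box (t := t - c) (y := p - c) (ρ := supNorm x) (fun j => ?_)
      have := ht' j
      simpa [sub_sub_sub_cancel_right] using this
    have hbox' : (supNorm (p - c) : ℝ) ≤ supNorm (t - c) + supNorm x := by exact_mod_cast hbox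
    calc |Δ_[Pi.single i 1] J t| = |J (t + Pi.single i 1) - J t| := by simp [fwdDiff]
      _ ≤ CΔ * Real.exp (-(γ / n) * (supNorm (t - c) : ℝ)) := hJ t i
      _ ≤ CΔ * (Real.exp ((γ / n) * (supNorm x : ℝ)) * Real.exp (-(γ / n) * (supNorm (p - c) : ℝ))) := by
          refine mul_le_mul_of_nonneg_left ?_ hCΔ
          rw [← Real.exp_add]
          exact Real.exp_le_exp.mpr (by nlinarith)
      _ = B := by rw [hB]; ring


end Summit.QuantumFields.BalabanUV.Beta.FP.SliceLoopWindowLetters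

end
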